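import Literature.Computability.Complexity.QBFUniversal
import Literature.Computability.Complexity.TseitinQBF
import HarnessLib

/-!
# Every prenex QBF is an instance of Trevisan–Vadhan's universal formula (TV07 (4.2)):
# the described-CNF assignment of a prenex 3-CNF QBF and its semantics

Literature / complexity — sequel of `QBFUniversal.lean` (the universal arithmetized QBF `f_{n,i}` with
selector-arithmetized prefix; `QBFUniv.HoldsL`, `eval_fam_zero_ubv`) and `TseitinQBF.lean` (every
prenex QBF has an equivalent prenex form with a CNF matrix). Here a prenex QBF `⟨qs, ofCNF C⟩` with a
CNF matrix (`V = |qs|` variables, `≤ n` clauses over variables `< V ≤ n`, `n ≥ 1`) is turned into the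
Boolean assignment of the universal variables of size `n` — TV07's `y(φ), z(φ)` ("`y_{jk} = 1` iff the
`j`-th clause contains `x_k`, `z_{jk} = 1` iff it contains `¬x_k`"), the selectors `s_k = qs_k`
(`∀`/`∃`; padding variables existential), padding clauses made trivially true (`x₀ ∨ ¬x₀`) — and the
truth of the QBF is identified with the value of the universal formula:

* `QBFUniv.HoldsFrom b k₀` — the prefix semantics from variable `k₀` on (`HoldsL` on the suffix of
  `finRange n`; `holdsFrom_of_le`, `holdsFrom_of_lt`);
* `QBFUniv.instOf n qs C` — the described-CNF assignment; `cnfHolds_iff_eval` (its matrix part holds iff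
  the CNF is true under the `x`-bits);
* **`QBFUniv.holdsFrom_iff_qbfEval`** — along assignments agreeing on the `x`-bits, `HoldsFrom b k₀` iff
  `qbfEval (ofCNF C) ((qs ++ ∃-padding).drop k₀) k₀ σ`; `qbfEval_append_replicate_false_iff` (padding
  quantifiers on absent variables are harmless);
* **`QBFUniv.isTrue_iff_holdsFrom_instOf`** — for a closed prenex QBF with CNF matrix,
  `IsTrue ↔ HoldsFrom (instOf n qs C) 0`; with `TseitinQBF.lean`, **`isTrue_iff_holdsFrom_tseitin`**:
  EVERY closed prenex QBF `ψ` is true iff the universal formula of size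
  `n = max (|qs| + size) (3 size + 1)` holds at the assignment described by its Tseitin form — the
  semantic content of the `PSPACE`-hardness of `f_{n,0}` (TV07 Lemma 4.1 (ii); `eval_fam_zero_ubv`
  turns it into `f_{n,0}(instOf …) = 1`).

Everything is proved; definitions are plain (no named facts). The polynomial-time emitter of the
instance bits (the Karp reduction proper) is a separate machine file.

## References

* [TrevisanVadhan2007] L. Trevisan, S. Vadhan, Comput. Complexity 16 (2007), §4, (4.1)–(4.2) and
  Lemma 4.1 (ii) (held text p. 12).
* [AroraBarakCC2009] S. Arora, B. Barak, CUP 2009, Def. 4.10 / Thm. 4.13 (`TQBF`), §8.3.1.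
-/

namespace Literature.Computability.Complexity

namespace QBFUniv

open Literature.Barriers.QuantumAdvantage Literature.Barriers.QuantumAdvantage.TQBFRed

variable {n : ℕ}

/-! ### The prefix semantics from a variable on -/

/-- Quantify the variables `x_{k₀}, x_{k₀+1}, …, x_{n-1}` as directed by the selectors, over the
described CNF. [cite: TrevisanVadhan2007, §4 (4.1)] -/
def HoldsFrom (b : UVar n → Bool) (k₀ : ℕ) : Prop := HoldsL b ((List.finRange n).drop k₀)

/-- `HoldsFrom b 0` is the semantics of the whole universal prefix. [folklore] -/
theorem holdsFrom_zero (b : UVar n → Bool) : HoldsFrom b 0 ↔ HoldsL b (List.finRange n) := by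
  rw [HoldsFrom, List.drop_zero]

/-- Past the last variable only the matrix remains. [folklore] -/
theorem holdsFrom_of_le (b : UVar n → Bool) {k₀ : ℕ} (h : n ≤ k₀) : HoldsFrom b k₀ ↔ CNFHolds b := by
  rw [HoldsFrom, List.drop_eq_nil_of_le (by simpa using h)]
  rfl

/-- One quantifier: `∀`/`∃ x_{k₀}` according to `s_{k₀}`. [folklore] -/
theorem holdsFrom_of_lt (b : UVar n → Bool) {k₀ : ℕ} (h : k₀ < n) :
    HoldsFrom b k₀ ↔
      if b (.s ⟨k₀, h⟩) then ∀ c : Bool, HoldsFrom (Function.update b (.x ⟨k₀, h⟩) c) (k₀ + 1)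
      else ∃ c : Bool, HoldsFrom (Function.update b (.x ⟨k₀, h⟩) c) (k₀ + 1) := by
  have hlen : k₀ < (List.finRange n).length := by simpa using h
  have hget : (List.finRange n)[k₀]'hlen = ⟨k₀, h⟩ := Fin.ext (by simp [List.getElem_finRange])
  rw [HoldsFrom, List.drop_eq_getElem_cons hlen, hget]
  simp only [HoldsL, HoldsFrom]

/-! ### The described-CNF assignment of a prenex CNF QBF -/

/-- **The instance assignment** (TV07's `y(φ), z(φ)`, with selectors and padding): clause `j < |C|`
is described by its literals; padding clauses `j ≥ |C|` contain `x₀` and `¬x₀`; selector `s_k = qs_k`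
(`true` = `∀`; padding variables existential); the `x`-bits are `0` (they get quantified).
[cite: TrevisanVadhan2007, §4 (4.2)] -/
def instOf (n : ℕ) (qs : List Bool) (C : CNF ℕ) : UVar n → Bool
  | .y j k => if hj : j.val < C.length then decide (((k.val, true) : Literal ℕ) ∈ C[j.val]) else decide (k.val = 0)
  | .z j k => if hj : j.val < C.length then decide (((k.val, false) : Literal ℕ) ∈ C[j.val]) else decide (k.val = 0)
  | .x _ => false
  | .s k => qs.getD k.val false

/-- Assignments of the universal variables that carry the instance description and whose `x`-bits
are `σ`. [folklore] -/
def Agrees (qs : List Bool) (C : CNF ℕ) (b : UVar n → Bool) (σ : ℕ → Bool) : Prop :=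
  (∀ j k, b (.y j k) = instOf n qs C (.y j k)) ∧ (∀ j k, b (.z j k) = instOf n qs C (.z j k)) ∧
    (∀ k, b (.s k) = instOf n qs C (.s k)) ∧ ∀ k : Fin n, b (.x k) = σ k.val

/-- The instance assignment agrees with itself and the all-`0` `x`-assignment. [folklore] -/
theorem agrees_instOf (qs : List Bool) (C : CNF ℕ) : Agrees (n := n) qs C (instOf n qs C) fun _ => false :=
  ⟨fun _ _ => rfl, fun _ _ => rfl, fun _ => rfl, fun _ => rfl⟩

/-- Agreement is stable under quantifying one variable on both sides. [folklore] -/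
theorem Agrees.update {qs : List Bool} {C : CNF ℕ} {b : UVar n → Bool} {σ : ℕ → Bool} (h : Agrees qs C b σ)
    (k : Fin n) (c : Bool) : Agrees qs C (Function.update b (.x k) c) (Function.update σ k.val c) := by
  obtain ⟨hy, hz, hs, hx⟩ := h
  refine ⟨fun j k' => ?_, fun j k' => ?_, fun k' => ?_, fun k' => ?_⟩
  · rw [Function.update_of_ne (by simp), hy]
  · rw [Function.update_of_ne (by simp), hz]
  · rw [Function.update_of_ne (by simp), hs]
  · by_cases hk : k' = k
    · subst hk; simp
    · rw [Function.update_of_ne (by simpa using hk), Function.update_of_ne (fun h' => hk (Fin.ext h')), hx]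

/-- **The matrix part**: along agreeing assignments, the described CNF holds iff `C` is true under `σ`
(clauses `j < |C|` literal by literal; padding clauses are true). Hypotheses: `|C| ≤ n`, all variables of
`C` are `< n`, and `n ≥ 1` (for the padding clause `x₀ ∨ ¬x₀`). [cite: TrevisanVadhan2007, §4 (4.2)] -/
theorem cnfHolds_iff_eval {qs : List Bool} {C : CNF ℕ} (hn : 1 ≤ n) (hC : C.length ≤ n)
    (hvar : ∀ c ∈ C, ∀ l ∈ c, l.1 < n) {b : UVar n → Bool} {σ : ℕ → Bool} (h : Agrees qs C b σ) :
    CNFHolds b ↔ C.eval σ = true := by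
  obtain ⟨hy, hz, -, hx⟩ := h
  rw [CNF.eval, List.all_eq_true]
  constructor
  · intro hH c hc
    obtain ⟨j, hj, rfl⟩ := List.getElem_of_mem hc
    obtain ⟨k, hk⟩ := hH ⟨j, lt_of_lt_of_le hj hC⟩
    rw [LitTrue, hy, hz, hx] at hk
    simp only [instOf, hj, ↓reduceDIte, decide_eq_true_eq] at hk
    simp only [List.any_eq_true]
    rcases hk with ⟨hm, hv⟩ | ⟨hm, hv⟩
    · exact ⟨_, hm, by simp [Literal.eval, hv]⟩
    · exact ⟨_, hm, by simp [Literal.eval, hv]⟩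
  · intro hE j
    by_cases hj : j.val < C.length
    · have hc := hE _ (List.getElem_mem hj)
      simp only [List.any_eq_true] at hc
      obtain ⟨⟨v, pol⟩, hm, hv⟩ := hc
      have hvn : v < n := hvar _ (List.getElem_mem hj) _ hm
      refine ⟨⟨v, hvn⟩, ?_⟩
      rw [LitTrue, hy, hz, hx]
      simp only [instOf, hj, ↓reduceDIte, decide_eq_true_eq]
      simp only [Literal.eval, beq_iff_eq] at hv
      cases pol
      · exact Or.inr ⟨hm, hv⟩
      · exact Or.inl ⟨hm, hv⟩
    · refine ⟨⟨0, hn⟩, ?_⟩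
      rw [LitTrue, hy, hz, hx]
      simp only [instOf, hj, ↓reduceDIte, decide_true]
      cases σ 0 <;> simp

/-! ### The prefix part -/

/-- **Prefix and matrix together**: along agreeing assignments, the universal semantics from `k₀` on is
the QBF semantics of `⟨qs ++ ∃^{n − |qs|}, ofCNF C⟩` from variable `k₀` on.
[cite: TrevisanVadhan2007, Lemma 4.1 (ii) / (4.2)] -/
theorem holdsFrom_iff_qbfEval {qs : List Bool} {C : CNF ℕ} (hn : 1 ≤ n) (hqs : qs.length ≤ n) (hC : C.length ≤ n)
    (hvar : ∀ c ∈ C, ∀ l ∈ c, l.1 < n) :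
    ∀ (t k₀ : ℕ), k₀ + t = n → ∀ {b : UVar n → Bool} {σ : ℕ → Bool}, Agrees qs C b σ →
      (HoldsFrom b k₀ ↔
        qbfEval (PropForm.ofCNF C) ((qs ++ List.replicate (n - qs.length) false).drop k₀) k₀ σ = true)
  | 0, k₀, hk, b, σ, h => by
    have hk' : n ≤ k₀ := by omega
    rw [holdsFrom_of_le b hk', List.drop_eq_nil_of_le (by simp; omega), qbfEval, PropForm.eval_ofCNF]
    exact cnfHolds_iff_eval hn hC hvar h
  | t + 1, k₀, hk, b, σ, h => by
    have hlt : k₀ < n := by omega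
    have hlen : k₀ < (qs ++ List.replicate (n - qs.length) false).length := by simp; omega
    rw [holdsFrom_of_lt b hlt, List.drop_eq_getElem_cons hlen, qbfEval]
    -- the selector is the quantifier
    have hsel : b (.s ⟨k₀, hlt⟩) = (qs ++ List.replicate (n - qs.length) false)[k₀] := by
      rw [h.2.2.1, instOf]
      simp only
      rw [List.getD_eq_getElem?_getD, List.getElem_append]
      split_ifs with hq
      · rw [List.getElem?_eq_getElem hq, Option.getD_some]
      · rw [List.getElem_replicate, List.getElem?_eq_none (by omega), Option.getD_none]
    have ih := fun c : Bool => holdsFrom_iff_qbfEval hn hqs hC hvar t (k₀ + 1) (by omega) (h.update ⟨k₀, hlt⟩ c)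
    simp only [] at ih
    rw [← hsel]
    cases b (.s ⟨k₀, hlt⟩)
    · simp only [Bool.false_eq_true, ↓reduceIte, cond_false, Bool.or_eq_true, ih, Bool.exists_bool]
    · simp only [↓reduceIte, cond_true, Bool.and_eq_true, ih, Bool.forall_bool]

/-- Existential quantifiers over variables that do not occur are harmless. [folklore] -/
theorem qbfEval_append_replicate_false_iff (φ : PropForm ℕ) (qs : List Bool) (hφ : propFormVarBound φ ≤ qs.length)
    (t : ℕ) (σ : ℕ → Bool) :
    qbfEval φ (qs ++ List.replicate t false) 0 σ = true ↔ qbfEval φ qs 0 σ = true := by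
  symm
  refine Tseitin.qbfEval_congr_matrix φ φ (List.replicate t false) qs.length (fun τ => ?_) qs 0 σ (by simp)
  rw [show List.replicate t false = List.replicate t false ++ [] by rw [List.append_nil],
    qbfEval_replicate_false_append]
  simp only [qbfEval]
  constructor
  · intro h
    refine ⟨List.replicate t false, by simp, ?_⟩
    rwa [propForm_eval_congr (τ := τ) fun x hx => writeVec_of_lt τ _ _ (lt_of_lt_of_le hx hφ)]
  · rintro ⟨w, -, h⟩
    rwa [propForm_eval_congr (τ := τ) fun x hx => writeVec_of_lt τ _ _ (lt_of_lt_of_le hx hφ)] at h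

/-- **A closed prenex QBF with CNF matrix is true iff the universal formula holds at its instance
assignment.** [cite: TrevisanVadhan2007, Lemma 4.1 (ii) / (4.2)] -/
theorem isTrue_iff_holdsFrom_instOf {qs : List Bool} {C : CNF ℕ} (hn : 1 ≤ n) (hqs : qs.length ≤ n)
    (hC : C.length ≤ n) (hvar : ∀ c ∈ C, ∀ l ∈ c, l.1 < qs.length) :
    (⟨qs, PropForm.ofCNF C⟩ : PrenexQBF).IsTrue ↔ HoldsFrom (instOf n qs C) 0 := by
  have hvar' : ∀ c ∈ C, ∀ l ∈ c, l.1 < n := fun c hc l hl => lt_of_lt_of_le (hvar c hc l hl) hqs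
  rw [holdsFrom_iff_qbfEval hn hqs hC hvar' n 0 (by simp) (agrees_instOf qs C), List.drop_zero,
    qbfEval_append_replicate_false_iff _ _ (Tseitin.propFormVarBound_ofCNF_le hvar), PrenexQBF.IsTrue]

/-- The size of the universal formula that receives the Tseitin form of `ψ`. [folklore] -/
def sizeOf (ψ : PrenexQBF) : ℕ := max (ψ.quants.length + ψ.matrix.size) (3 * ψ.matrix.size + 1)

/-- **Every closed prenex QBF is an instance of the universal formula** (through its Tseitin form):
`ψ` is true iff `HoldsFrom (instOf (sizeOf ψ) qs' C) 0`, `qs' = qs ++ ∃^{size}`, `C` the Tseitin 3-CNF.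
[cite: TrevisanVadhan2007, Lemma 4.1 (ii)] -/
theorem isTrue_iff_holdsFrom_tseitin {ψ : PrenexQBF} (h : ψ.IsClosed) :
    ψ.IsTrue ↔ HoldsFrom (instOf (sizeOf ψ) (Tseitin.tseitinQBF ψ).quants
      (Tseitin.cnf ψ.matrix ψ.quants.length)) 0 := by
  rw [← Tseitin.isTrue_tseitinQBF_iff h]
  have hs := PropForm.size_pos ψ.matrix
  refine isTrue_iff_holdsFrom_instOf (by rw [sizeOf]; omega) (by simp [sizeOf]) ?_ ?_
  · rw [Tseitin.cnf, List.length_append, List.length_singleton, sizeOf]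
    have := Tseitin.length_gates_le ψ.matrix ψ.quants.length
    omega
  · intro c hc l hl
    simp only [List.length_append, List.length_replicate]
    rw [Tseitin.cnf, List.mem_append] at hc
    rcases hc with hc | hc
    · exact Tseitin.gates_vars_lt ψ.matrix _ h c hc l hl
    · simp at hc; subst hc; simp at hl; subst hl
      rw [Tseitin.root]; omega

end QBFUniv

end Literature.Computability.Complexity
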